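import Mathlib
import Summits.KontsevichZagierPeriods.Zeta5Search.Families.DualConstantTerm
import HarnessLib

/-!
# ζ(5) search — Families: CONJECTURE D-exact as a binomial identity, and kernel-DECIDED instances

HONEST FRAMING: systematic search; no irrationality claim unless certified.  Exact integer identities between two finite
binomial sums (seat P2, Families layer); nothing about the arithmetic of ζ(5); no record moves.

`Families/DualConstantTerm.lean` typed CONJECTURE D-exact: `|Q(a)| = dualConstantTerm a`, the constant term of the cellular
integrand in the gap coordinates of the DUAL cell (`MvPolynomial` coefficient).  Extracting the coefficient variable by
variable (`g₅, g₀, g₄, g₁, g₃`; `HOME/pub-zeta5-p2/g6/ct_binomial.py`) turns that constant term into an explicit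
terminating 4-fold binomial sum `dualCTBinom a` — so D-exact is the hypergeometric multi-sum identity
`dualCTBinom a = |Qcoeff (pOf a) (qOf a)|` (a creative-telescoping target).  Here:
* `dualCTBinom` — the 4-fold sum (computable, `zchoose`);
* `@[conjecture] LeadingCoeffIsDualCTBinom` — the binomial form of D-exact (INTERNALLY MINTED; evidence: 31/31 exact
  checks incl. the record parameters, where both sides are `886552076180369368223636861952000`);
* **DECIDED INSTANCES** (`decide`, kernel): the diagonal `n = 1, 2` — `21 = |Q₁|`, `2989 = |Q₂|` (Zudilin's ζ(5)
  numbers) — and the asymmetric `a = (1,2,1,2,1,2,2,1)` (`133`) and `(1,1,1,1,1,1,2,1)` (`16 = |−16|`).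
(The equality `dualCTBinom a = dualConstantTerm a` of the two renderings of the constant term is checked outside the
kernel only — `ct_binomial.py` vs `ct_test.py`; it is bookkeeping of one coefficient extraction.)
UPDATE (retag, P2 g8, 2026-08-22): `LeadingCoeffIsDualCTBinom` is now a THEOREM of the tree —
`leadingCoeffIsDualCTBinom_holds` (`Families/DualConstantTermBinomial`: the bookkeeping identity
`dualCTBinom_eq_dualConstantTerm` IS in the kernel now, composed with cert-2 g8's D-exact
`DualR.leadingCoeffIsDualConstantTerm_holds`); the `@[conjecture]` attribute is therefore removed; statement and
name unchanged (the word CONJECTURE in the docstring below is historical).  Standard axioms only.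
-/

namespace Summit.KontsevichZagierPeriods.Zeta5Search.Families.Cellular

open Finset
open Literature.NumberTheory.Irrationality
open Literature.NumberTheory.Irrationality.BrownZudilin2022 (zchoose)

/-- **The dual constant term as a 4-fold binomial sum** (coefficient extraction in the order `g₅, g₀, g₄, g₁, g₃`):
with `A = bzNum a`, `B = bzDen a`,
`Σ_{j,i,l,r} C(A₁,j)C(A₂,B₅−j)·C(A₆,i)C(A₇,B₀−i)·C(A₁−j,l)C(A₂+A₃−B₅+j+l,B₄)·C(A₆−i,r)C(A₀+A₇−B₀+i+r,B₁−A₁+j+l)C(A₂+A₃−B₅+j+l−B₄,B₃−A₆+i+r)`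
(`zchoose n k = 0` unless `0 ≤ k ≤ n`). -/
def dualCTBinom (a : Fin 8 → ℤ) : ℤ :=
  let A := bzNum a
  let B := bzDen a
  ∑ j ∈ range ((B 5).toNat + 1), ∑ i ∈ range ((B 0).toNat + 1), ∑ l ∈ range ((A 1).toNat + 1),
    ∑ r ∈ range ((A 6).toNat + 1),
      zchoose (A 1) j * zchoose (A 2) (B 5 - j) * (zchoose (A 6) i * zchoose (A 7) (B 0 - i)) *
        (zchoose (A 1 - j) l * zchoose (A 2 + A 3 - B 5 + j + l) (B 4)) *
        (zchoose (A 6 - i) r * zchoose (A 0 + A 7 - B 0 + i + r) (B 1 - A 1 + j + l) *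
          zchoose (A 2 + A 3 - B 5 + j + l - B 4) (B 3 - A 6 + i + r))

/-- **CONJECTURE D-exact, binomial form (INTERNALLY MINTED; P2 g6).**  For `bzNum a ≥ 0`, `bzDen a ≥ 0`:
`|Q(a)| = dualCTBinom a`.  Evidence: `HOME/pub-zeta5-p2/g6/DUAL-RATES.md` (31/31, record included); instances below.
[evidence: HOME/pub-zeta5-p2/g6/ct_binomial.py] -/
def LeadingCoeffIsDualCTBinom : Prop :=
  ∀ a : Fin 8 → ℤ, (∀ i, 0 ≤ bzNum a i) → (∀ i, 0 ≤ bzDen a i) → |BrownZudilin2022.QOf a| = dualCTBinom a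

/-- Instance `n = 1` of the diagonal: `dualCTBinom (1,…,1) = 21 = |Q₁|`. -/
theorem dualCTBinom_diag_one : dualCTBinom (fun _ => 1) = 21 ∧ |BrownZudilin2022.QOf (fun _ => 1)| = 21 := by
  constructor <;> decide

/-- Instance `n = 2` of the diagonal: `dualCTBinom (2,…,2) = 2989 = |Q₂|`. -/
theorem dualCTBinom_diag_two : dualCTBinom (fun _ => 2) = 2989 ∧ |BrownZudilin2022.QOf (fun _ => 2)| = 2989 := by
  constructor <;> decide

/-- An asymmetric instance: `a = (1,2,1,2,1,2,2,1)`: both sides are `133`. -/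
theorem dualCTBinom_inst_a : dualCTBinom ![1, 2, 1, 2, 1, 2, 2, 1] = 133 ∧
    |BrownZudilin2022.QOf ![1, 2, 1, 2, 1, 2, 2, 1]| = 133 := by
  constructor <;> decide

/-- An instance with a negative `Q`: `a = (1,1,1,1,1,1,2,1)`: `dualCTBinom = 16 = |−16| = |Q(a)|`. -/
theorem dualCTBinom_inst_b : dualCTBinom ![1, 1, 1, 1, 1, 1, 2, 1] = 16 ∧
    BrownZudilin2022.QOf ![1, 1, 1, 1, 1, 1, 2, 1] = -16 := by
  constructor <;> decide

end Summit.KontsevichZagierPeriods.Zeta5Search.Families.Cellular
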